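import Mathlib

/-!
# Wall siege — `stub_tangencySets` of line `Sketch` (crux `LevelOneGL2Designs`, stmt-MatrixMultiplication-14080)

**STATUS 2026-08-16T20:50Z: every sub-stub in this file has been PROVED AND LANDED by the wallb / ccert seats
(`…TangencyCertificates`, `…StubTangencySetsUnitalBoundExact`, `…ParabolaFree{Instances,Exact,Exact11}`, seat 3's
`FlagLine.stub_tangencyAt_3_not_5`); the `sorry`s below are kept as the registration record only.  Round 2 lives in
`WallTangencyStubsR2.lean`; the map is `DECOMPOSITIONS.md` (revision 2).**

Planner work file (siege-plan seat `planner-sgplan-stmt-MatrixMultiplication-14080-wall-plan-0`, 2026-08-16).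
Companion prose: `Cruxes/LevelOneGL2Designs/DECOMPOSITIONS.md` (the three construction families reduced to
finite statements, the census of small values, and which sub-stub each family feeds).

The registered wall stub (skeleton `Lines/Sketch.lean`, sha 6a77842c…) reads
`∃ c > 0, ∀ p₀, ∃ prime p ≥ p₀, ∃ S ⊆ 𝔽_p² × 𝔽_p², c·p^{3/2} ≤ |S| ∧ ∀ f f' ∈ S, (f.1 ⬝ᵥ f'.2 = 1 ↔ f = f')`
— a point/line INDUCED MATCHING ("strong representative system", "tangency set") of the affine plane AG(2,p) with
lines `{x | b ⬝ᵥ x = 1}` avoiding the origin, at the Illés–Szőnyi–Wettl scale p^{3/2}.  This file fixes `p`: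

* `TangencySetAt p N` — the fixed-`p` slice (same matrix as the stub, `N ≤ |S|`);
* SUB-STUBS (sorried, registered on stmt-14080 with `ledger workitem stub-add`; each is decidable at fixed `p`, i.e.
  certificate-shaped: an explicit `S` + `decide`/`native_decide` proves a lower-bound instance, an LRAT/DRAT refutation
  of the CNF in the kit job's `outputs/cnf/` (variable map attached) settles an upper-bound instance):
  exact values `T(3) = 4`, `T(5) = 10`, `T(7) = 17` (lower + upper instance each), record lower bounds
  `T(11) ≥ 33` (Singer multicoset), `T(13) ≥ 41` (SA), the parabola-free ("family P2-mod") values `α₇ = 10`,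
  `α₁₁ = 23` in the hypothesis shape of the wallb lemma `tangency_of_parabolaFree`, and the uniform lemma
  `stub_tangency_isw_bound` ((|S|−1)² ≤ p³, the ISW / Thas–Hubaut count; the parabola-pencil transfer is NOT repeated
  here — wallb stubs `srs_of_coclique`, `pencil_srs`, `paley_lift` cover it);
* kernel-checked glue: monotonicity in `N`, the cap `¬ TangencySetAt p N` from the ISW stub when `p³ < (N−1)²`,
  and `tangencySets_iff_slices` (the wall stub ⇔ a family of slices with `c·p^{3/2} ≤ N`);
* feasibility checks (`WallTangencyChecks.lean`): `⟨S, by decide⟩` closes the p = 3, 5, 7 instances axiom-free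
  (≈ 1 s, 5 s, 35 s); the p = 11, 13 witnesses are validated with `native_decide`, the parabola-free set at p = 7 with
  `decide` — every witness quoted below has been checked by the Lean kernel/compiler on the farm (rc 0).

Nothing here concludes the crux (the line `Sketch` is dead at `stub_flagTransfer`, see `Lines/Sketch-dead.md`);
the sub-stubs calibrate the one open stub of that line, `c(p) := T(p)/p^{3/2}`, by certified finite values.
-/

namespace Summit.MatrixMultiplication.MatrixMultiplication.Cruxes.LevelOneGL2Designs.WallTangency

open Matrix

/-- Fixed-`p` slice of `stub_tangencySets`: an induced point/line matching of size `≥ N` in AG(2,p) with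
origin-avoiding lines (`f = (a, b)`: point `a`, line `{x | b ⬝ᵥ x = 1}`). -/
def TangencySetAt (p N : ℕ) : Prop :=
  ∃ S : Finset ((Fin 2 → ZMod p) × (Fin 2 → ZMod p)), N ≤ S.card ∧
    ∀ f ∈ S, ∀ f' ∈ S, (dotProduct f.1 f'.2 = 1 ↔ f = f')

/-- The wall stub itself (verbatim signature of `stub_tangencySets` in `Lines/Sketch.lean`). -/
def TangencySets : Prop :=
  ∃ c : ℝ, 0 < c ∧ ∀ p₀ : ℕ, ∃ (p : ℕ) (_ : Fact p.Prime), p₀ ≤ p ∧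
    ∃ S : Finset ((Fin 2 → ZMod p) × (Fin 2 → ZMod p)), c * (p : ℝ) ^ (3 / 2 : ℝ) ≤ S.card ∧
      ∀ f ∈ S, ∀ f' ∈ S, (dotProduct f.1 f'.2 = 1 ↔ f = f')

/-! ## Glue (kernel-checked) -/

theorem tangencySetAt_mono {p N N' : ℕ} (h : N' ≤ N) : TangencySetAt p N → TangencySetAt p N' := by
  rintro ⟨S, hN, hS⟩
  exact ⟨S, h.trans hN, hS⟩

theorem tangencySetAt_zero (p : ℕ) : TangencySetAt p 0 :=
  ⟨∅, by simp, by simp⟩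

/-- The wall stub is exactly "some slice family at scale `c·p^{3/2}`". -/
theorem tangencySets_iff_slices :
    TangencySets ↔ ∃ c : ℝ, 0 < c ∧ ∀ p₀ : ℕ, ∃ (p : ℕ) (_ : Fact p.Prime), p₀ ≤ p ∧
      ∃ N : ℕ, c * (p : ℝ) ^ (3 / 2 : ℝ) ≤ N ∧ TangencySetAt p N := by
  constructor
  · rintro ⟨c, hc, h⟩
    refine ⟨c, hc, fun p₀ => ?_⟩
    obtain ⟨p, hp, hle, S, hS, hsep⟩ := h p₀
    exact ⟨p, hp, hle, S.card, hS, S, le_rfl, hsep⟩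
  · rintro ⟨c, hc, h⟩
    refine ⟨c, hc, fun p₀ => ?_⟩
    obtain ⟨p, hp, hle, N, hN, S, hNS, hsep⟩ := h p₀
    exact ⟨p, hp, hle, S, hN.trans (by exact_mod_cast hNS), hsep⟩

/-! ## Uniform sub-stubs (all `p`) -/

/-- SUB-STUB (support, M): the Illés–Szőnyi–Wettl / Thas–Hubaut bound in the affine stub form: an induced
point/line matching `S` of AG(2,p) satisfies `(|S| − 1)² ≤ p³` (so the wall stub needs `c ≤ 1`).  Proof sketch
(DECOMPOSITIONS.md §1): embed in PG(2,p); with `k_ℓ = |ℓ ∩ T|`, `Σ k_ℓ = N(p+1)`, `Σ k_ℓ(k_ℓ−1) = N(N−1)`; drop the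
`N` designated tangents and apply Cauchy–Schwarz over the remaining `p²+p+1−N` lines. -/
theorem stub_tangency_isw_bound : ∀ (p : ℕ) [Fact p.Prime] (S : Finset ((Fin 2 → ZMod p) × (Fin 2 → ZMod p))), (∀ f ∈ S, ∀ f' ∈ S, (dotProduct f.1 f'.2 = 1 ↔ f = f')) → (S.card - 1) ^ 2 ≤ p ^ 3 := by
  sorry

/-- Glue: a numeric cap from the ISW stub. -/
theorem not_tangencySetAt_of_isw
    (hisw : ∀ (p : ℕ) [Fact p.Prime] (S : Finset ((Fin 2 → ZMod p) × (Fin 2 → ZMod p))),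
      (∀ f ∈ S, ∀ f' ∈ S, (dotProduct f.1 f'.2 = 1 ↔ f = f')) → (S.card - 1) ^ 2 ≤ p ^ 3)
    {p N : ℕ} [Fact p.Prime] (hN : p ^ 3 < (N - 1) ^ 2) : ¬ TangencySetAt p N := by
  rintro ⟨S, hNS, hS⟩
  have h1 := hisw p S hS
  have h2 : (N - 1) ^ 2 ≤ (S.card - 1) ^ 2 := Nat.pow_le_pow_left (Nat.sub_le_sub_right hNS 1) 2
  omega

/-! ## Small-`p` instances (certificate-shaped sub-stubs)

`T(p)` := the largest `N` with `TangencySetAt p N`.  Census (this seat, exact B&B with flag-transitivity symmetry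
breaking, re-derived by SAT in kit j018699 with CNF + variable map + proof files under `outputs/cnf/`):
`T(3) = 4`, `T(5) = 10`, `T(7) = 17`; projective SRS maxima `6, 12, 19 = ⌊p√p + 1⌋` (ISW-tight for p ≤ 7).
Lower-bound instances carry their witness in the docstring; they are provable by `⟨S, by decide⟩`-style terms
(checked below as `example`s for p = 3, 5, 7). -/

/-- SUB-STUB (instance): `T(3) ≥ 4`.  Witness: `({(![0, 1], ![0, 1]), (![2, 2], ![0, 2]), (![2, 0], ![2, 2]), (![1, 0], ![1, 2])} : Finset ((Fin 2 → ZMod 3) × (Fin 2 → ZMod 3)))`. -/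
theorem stub_tangencyAt_3_4 : ∃ S : Finset ((Fin 2 → ZMod 3) × (Fin 2 → ZMod 3)), 4 ≤ S.card ∧ ∀ f ∈ S, ∀ f' ∈ S, (dotProduct f.1 f'.2 = 1 ↔ f = f') := by
  sorry

/-- SUB-STUB (instance, negative): `T(3) ≤ 4` (exhaustive; 24 flags). LRAT target `taff_p3_N5.cnf`. -/
theorem stub_tangencyAt_3_not_5 : ¬ ∃ S : Finset ((Fin 2 → ZMod 3) × (Fin 2 → ZMod 3)), 5 ≤ S.card ∧ ∀ f ∈ S, ∀ f' ∈ S, (dotProduct f.1 f'.2 = 1 ↔ f = f') := by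
  sorry

/-- SUB-STUB (instance): `T(5) ≥ 10`.  Witness: `({(![0, 1], ![0, 1]), (![4, 4], ![2, 2]), (![4, 2], ![2, 4]), (![4, 3], ![0, 2]), (![3, 4], ![2, 0]), (![2, 4], ![4, 2]), (![2, 2], ![4, 4]), (![2, 0], ![3, 4]), (![1, 0], ![1, 0]), (![0, 2], ![4, 3])} : Finset ((Fin 2 → ZMod 5) × (Fin 2 → ZMod 5)))`. -/
theorem stub_tangencyAt_5_10 : ∃ S : Finset ((Fin 2 → ZMod 5) × (Fin 2 → ZMod 5)), 10 ≤ S.card ∧ ∀ f ∈ S, ∀ f' ∈ S, (dotProduct f.1 f'.2 = 1 ↔ f = f') := by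
  sorry

/-- SUB-STUB (instance, negative): `T(5) ≤ 10` (B&B exact, 120 flags; LRAT target `taff_p5_N11.cnf`). -/
theorem stub_tangencyAt_5_not_11 : ¬ ∃ S : Finset ((Fin 2 → ZMod 5) × (Fin 2 → ZMod 5)), 11 ≤ S.card ∧ ∀ f ∈ S, ∀ f' ∈ S, (dotProduct f.1 f'.2 = 1 ↔ f = f') := by
  sorry

/-- SUB-STUB (instance): `T(7) ≥ 17`.  Witness: `({(![0, 1], ![0, 1]), (![6, 6], ![4, 2]), (![6, 5], ![0, 3]), (![6, 2], ![3, 2]), (![5, 4], ![4, 4]), (![5, 6], ![1, 4]), (![5, 3], ![4, 3]), (![6, 0], ![6, 3]), (![4, 0], ![2, 0]), (![3, 2], ![5, 0]), (![2, 6], ![5, 2]), (![2, 4], ![3, 4]), (![2, 3], ![1, 2]), (![2, 2], ![1, 3]), (![1, 4], ![1, 0]), (![0, 6], ![3, 6]), (![0, 3], ![5, 5])} : Finset ((Fin 2 → ZMod 7) × (Fin 2 → ZMod 7)))`. -/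
theorem stub_tangencyAt_7_17 : ∃ S : Finset ((Fin 2 → ZMod 7) × (Fin 2 → ZMod 7)), 17 ≤ S.card ∧ ∀ f ∈ S, ∀ f' ∈ S, (dotProduct f.1 f'.2 = 1 ↔ f = f') := by
  sorry

/-- SUB-STUB (instance, negative): `T(7) ≤ 17` (B&B exact in 71 s with flag-transitivity symmetry breaking, 336
flags; note the PROJECTIVE maximum is 19 = ⌊7√7+1⌋, the cyclic semioval of PG(2,7); LRAT target `taff_p7_N18.cnf`). -/
theorem stub_tangencyAt_7_not_18 : ¬ ∃ S : Finset ((Fin 2 → ZMod 7) × (Fin 2 → ZMod 7)), 18 ≤ S.card ∧ ∀ f ∈ S, ∀ f' ∈ S, (dotProduct f.1 f'.2 = 1 ↔ f = f') := by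
  sorry

/-- SUB-STUB (instance): `T(11) ≥ 33` — from the Singer multicoset SRS of size 35 in PG(2,11) (m = 7, |J| = 5,
DECOMPOSITIONS.md §2.U2) pushed to the best affine chart; beats the three search campaigns on record (32). Witness
(also `witness_p11_33.json` on the item): `({(![0, 1], ![7, 1]), (![0, 5], ![10, 9]), (![0, 6], ![4, 2]), (![1, 1], ![4, 8]), (![1, 2], ![7, 8]), (![1, 3], ![4, 10]), (![1, 6], ![5, 3]), (![1, 9], ![0, 5]), (![2, 3], ![8, 6]), (![2, 5], ![10, 5]), (![2, 10], ![2, 3]), (![3, 1], ![8, 10]), (![3, 5], ![9, 8]), (![3, 6], ![6, 10]), (![3, 8], ![0, 7]), (![4, 2], ![9, 10]), (![4, 7], ![10, 7]), (![4, 10], ![1, 3]), (![5, 1], ![3, 8]), (![5, 2], ![3, 4]), (![5, 5], ![5, 4]), (![6, 7], ![2, 0]), (![7, 1], ![1, 5]), (![7, 2], ![6, 7]), (![7, 4], ![0, 3]), (![7, 10], ![1, 6]), (![8, 2], ![8, 7]), (![8, 7], ![1, 10]), (![8, 10], ![2, 4]), (![9, 7], ![5, 0]), (![10, 3], ![8,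 3]), (![10, 5], ![7, 6]), (![10, 10], ![2, 8])} : Finset ((Fin 2 → ZMod 11) × (Fin 2 → ZMod 11)))`. -/
theorem stub_tangencyAt_11_33 : ∃ S : Finset ((Fin 2 → ZMod 11) × (Fin 2 → ZMod 11)), 33 ≤ S.card ∧ ∀ f ∈ S, ∀ f' ∈ S, (dotProduct f.1 f'.2 = 1 ↔ f = f') := by
  sorry

/-- SUB-STUB (instance): `T(13) ≥ 41` (simulated annealing, `kitjob/sa.py`; ISW floor 47). Witness
(`witness_p13_41.json`): `({(![0, 2], ![12, 7]), (![0, 4], ![12, 10]), (![0, 7], ![11, 2]), (![0, 11], ![11, 6]), (![1, 1], ![6, 8]), (![1, 2], ![6, 4]), (![1, 3], ![0, 9]), (![1, 10], ![11, 12]), (![1, 11], ![4, 8]), (![1, 12], ![6, 5]), (![2, 11], ![7, 0]), (![3, 0], ![9, 11]), (![3, 1], ![1, 11]), (![3, 4], ![7, 8]), (![3, 5], ![0, 8]), (![3, 11], ![1, 1]), (![4, 6], ![10, 0]), (![5, 0], ![8, 9]), (![5, 1], ![1, 9]), (![5, 6], ![2, 5]), (![5, 7], ![1, 5]), (![6,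 4], ![11, 0]), (![7, 12], ![2, 0]), (![8, 0], ![5, 1]), (![8, 4], ![6, 11]), (![8, 7], ![1, 12]), (![8, 8], ![2, 3]), (![9, 0], ![3, 3]), (![9, 6], ![1, 3]), (![9, 9], ![0, 3]), (![9, 10], ![7, 12]), (![9, 11], ![10, 12]), (![9, 12], ![4, 9]), (![10, 1], ![10, 5]), (![10, 2], ![6, 3]), (![10, 7], ![12, 9]), (![11, 2], ![7, 1]), (![11, 4], ![2, 11]), (![11, 7], ![7, 4]), (![11, 8], ![10, 1]), (![12, 7], ![12, 0])} : Finset ((Fin 2 → ZMod 13) × (Fin 2 → ZMod 13)))`. -/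
theorem stub_tangencyAt_13_41 : ∃ S : Finset ((Fin 2 → ZMod 13) × (Fin 2 → ZMod 13)), 41 ≤ S.card ∧ ∀ f ∈ S, ∀ f' ∈ S, (dotProduct f.1 f'.2 = 1 ↔ f = f') := by
  sorry

/-! ### Family P2-mod instances (parabola-free sets of `ℤ_p²`, hypothesis shape of wallb `tangency_of_parabolaFree`)

`α_p` := the largest `T ⊆ ℤ_p × ℤ_p` with no two points differing by `(r, ±r²)`, `r ≠ 0`.  Exact (B&B, translation
symmetry): `α₅ = 10`, `α₇ = 10`, `α₁₁ = 23`; Hoffman bounds 11.2, 12.9, 34.7 (= `p^{3/2}` exactly when p ≡ 1 mod 4). -/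

/-- SUB-STUB (instance): `α₇ ≥ 10`.  Witness: `({(0, 0), (1, 3), (1, 4), (4, 3), (4, 4), (5, 0), (6, 2), (6, 3), (6, 4), (6, 5)} : Finset (ZMod 7 × ZMod 7))`. -/
theorem stub_parabolaFreeAt_7_10 : ∃ T : Finset (ZMod 7 × ZMod 7), 10 ≤ T.card ∧ ∀ t ∈ T, ∀ t' ∈ T, (t'.1 - t.1) ^ 2 = t.2 - t'.2 → t'.1 = t.1 := by
  sorry

/-- SUB-STUB (instance, negative): `α₇ ≤ 10` (B&B exact; CNF on request — the graph has 49 vertices). -/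
theorem stub_parabolaFreeAt_7_not_11 : ¬ ∃ T : Finset (ZMod 7 × ZMod 7), 11 ≤ T.card ∧ ∀ t ∈ T, ∀ t' ∈ T, (t'.1 - t.1) ^ 2 = t.2 - t'.2 → t'.1 = t.1 := by
  sorry

/-- SUB-STUB (instance): `α₁₁ ≥ 23`.  Witness: `({(0, 0), (0, 1), (0, 2), (0, 3), (1, 6), (1, 7), (1, 8), (2, 1), (2, 2), (7, 1), (7, 2), (8, 6), (8, 7), (8, 8), (9, 0), (9, 1), (9, 2), (9, 3), (10, 5), (10, 6), (10, 7), (10, 8), (10, 9)} : Finset (ZMod 11 × ZMod 11))`. -/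
theorem stub_parabolaFreeAt_11_23 : ∃ T : Finset (ZMod 11 × ZMod 11), 23 ≤ T.card ∧ ∀ t ∈ T, ∀ t' ∈ T, (t'.1 - t.1) ^ 2 = t.2 - t'.2 → t'.1 = t.1 := by
  sorry

/-- SUB-STUB (instance, negative): `α₁₁ ≤ 23` (B&B exact in 1.4 s with translation symmetry; 121 vertices). -/
theorem stub_parabolaFreeAt_11_not_24 : ¬ ∃ T : Finset (ZMod 11 × ZMod 11), 24 ≤ T.card ∧ ∀ t ∈ T, ∀ t' ∈ T, (t'.1 - t.1) ^ 2 = t.2 - t'.2 → t'.1 = t.1 := by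
  sorry

/-! ## Feasibility check for the certificate tactic (not a stub; the p = 5, 7, 11, 13 and parabola-free
validations live in `WallTangencyChecks.lean`, ≈ 4 min of elaboration) -/

set_option maxRecDepth 4000 in
example : ∃ S : Finset ((Fin 2 → ZMod 3) × (Fin 2 → ZMod 3)), 4 ≤ S.card ∧
    ∀ f ∈ S, ∀ f' ∈ S, (dotProduct f.1 f'.2 = 1 ↔ f = f') :=
  ⟨({(![0, 1], ![0, 1]), (![2, 2], ![0, 2]), (![2, 0], ![2, 2]), (![1, 0], ![1, 2])} : Finset ((Fin 2 → ZMod 3) × (Fin 2 → ZMod 3))), by decide⟩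

end Summit.MatrixMultiplication.MatrixMultiplication.Cruxes.LevelOneGL2Designs.WallTangency
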